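import Literature.MathematicalPhysics.QuantumFieldTheory.Balaban1983to89.B1Eq324BenfattoKernelRegression
import Literature.MathematicalPhysics.QuantumFieldTheory.Balaban1983to89.B1Eq324BenfattoKernelOfPrecision
import Literature.MathematicalPhysics.QuantumFieldTheory.Balaban1983to89.B1Eq324BenfattoClassDecoupling
import HarnessLib

/-!
# `Balaban1983to89.B1Eq324BenfattoKernelComparison` — [BenfattoEtAl1978] §5 (5.13) p. 155 for the class of [Balaban1985BackgroundPropagators]
# Sect. E p. 428: the FINITE-WINDOW LAWS of the Gaussian field of a general kernel on `Q₀` and of its conditioned fields, in the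
# `multivariateGaussian` currency of seat n08-b's Gaussian domination, and the domination TRANSFERRED to the fields the §5 chain integrates against,
# PROVED

statement-level skeleton of published theorems with citation tags; proofs where landed; nothing here is a claim about the
Yang–Mills mass gap

WHY THIS MODULE (cell `pub-ymgap`, seat `dag-n08-d` gen 11, OFFER-47 (J2) worded «BOTH» by seat n08-b; node N08 [Balaban1985UV3]; the
[BenfattoEtAl1978] source chain behind the (α)-row `h324`).  At T. Bałaban's data the precision of the fluctuation field is exponentially decaying,
NOT of finite range ([Balaban1985BackgroundPropagators] Sect. E p. 428, (3.156)), so the exact Markov factorisation «the integral factorizes» of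
(5.13) p. 155 is replaced by a DECOUPLING estimate: seat n08-b's `…B1Eq324BenfattoClassDecoupling` proves, for positive-definite precisions with
two-sided comparable quadratic forms, the domination `∫F dN(m,P₁⁻¹) ≶ c^{±|ι|} ∫F dN(m,((1∓δ)P₂)⁻¹)` — stated on `multivariateGaussian m P⁻¹` over
`EuclideanSpace ℝ ι`.  The §5 chain integrates against the FIELD `gaussianFieldOfKernel K` on `Q₀ → ℝ` and the conditioned fields
`(gaussianFieldOfKernel (condCov K Γ)).map (ζ ↦ u_Γ(z̄) + ζ)` (`…KernelCondField`).  This file is the second junction piece: the finite-dimensional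
law of a (shifted) Gaussian field on a window `I` IS `multivariateGaussian (u|_I) (covGram K I)` (the tree's Kolmogorov construction
`CurvatureGaussianField.gaussianFieldOfKernel_map_restrict`), so n08-b's domination holds between the fields for every observable of the
`I`-coordinates, under the displayed identification of the Gram matrices with the inverse precisions.

WHAT IS PROVED (standard axioms; no `sorry`; no definition).  `K, K₁, K₂ : Q₀ → Q₀ → ℝ` positive-semidefinite kernels, `I ⊂ Q₀` finite,
`u : Q₀ → ℝ` a shift, `F : (I → ℝ) → ℝ≥0∞` measurable.
* §1 FINITE-WINDOW LAWS: `lintegral_comp_restrict_eq` (`∫⁻ F(z|_I) d𝒩(0,K) = ∫⁻ F dN(0, K_II)`), `integral_comp_restrict_eq` (real-valued twin),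
  ★ `lintegral_comp_restrict_shift_eq` (`∫⁻ F(z|_I) d[𝒩(0,K) ∘ (ζ ↦ u + ζ)⁻¹] = ∫⁻ F dN(u|_I, K_II)`), `lintegral_comp_restrict_condFieldK_eq`
  (the conditioned field of `…KernelCondField`: `N(u_C(z̄)|_I, C^C_II)`).
* §2 DOMINATION TRANSFERRED TO THE FIELDS: ★★ `lintegral_restrict_le_of_form_le` / ★★ `lintegral_restrict_ge_of_form_le` — if `K₁_II = P₁⁻¹`,
  `K₂_II = ((1∓δ)P₂)⁻¹` with `(1−δ)⟨v,P₂v⟩ ≤ ⟨v,P₁v⟩ ≤ (1+δ)⟨v,P₂v⟩`, then `∫⁻ F(z|_I) d𝒩(0,K₁) ≤ (√((1+δ)/(1−δ)))^{|I|} ∫⁻ F(z|_I) d𝒩(0,K₂)`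
  (and the lower twin); ★★ `lintegral_restrict_shift_le_of_form_le` / `…_ge_…` — the same between the SHIFTED fields with a common centre `u`
  (the conditioned fields of the chain: centre `u_Γ(z̄)`, Gram matrix `C^Γ_II`).
* §3 ASSEMBLY FOR THE PRECISION CLASS (`…KernelOfPrecision`'s zero-extended kernel `K` of a coercive, exponentially decaying precision `A` on
  `Λ`, corridors `Γ ⊆ Λ`, a partition of `Λ ∖ Γ` into `w`-separated boxes, `δ = M₂e^{−κ′w}/γ < 1`): `coercive_submatrix_sdiff`,
  `rowSum_submatrix_sdiff_le` (the block `A|_{Λ∖Γ}` inherits the class constants), ★★★ `lintegral_restrict_condFieldK_le_blockDiag` /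
  `lintegral_restrict_condFieldK_ge_blockDiag` — the conditioned class field `P̄^K_{Γ,z̄}` on the `Λ ∖ Γ`-coordinates is dominated both ways, with
  the factor `(√((1±δ)/(1∓δ)))^{|Λ∖Γ|}`, by ANY positive-semidefinite kernel whose Gram matrix on `Λ ∖ Γ` is the box-block-diagonal Dirichlet
  precision at temperature `1 ∓ δ`, inverted — shifted by the SAME centre `u_Γ(z̄)` (n08-b's `decoupling` + §2 + the Dirichlet Gram identity).
* §4 THE COMPARISON FIELD FACTORISES: `isGaussianProcess_shift`, `covariance_eval_shift`, ★★ `iIndepFun_shift_of_kernel_eq_zero` (pairwise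
  `K`-decoupled regions are mutually independent under ANY deterministic shift of `𝒩(0,K)`), ★ `integral_prod_eq_prod_integral_shift` («the
  integral factorizes», (5.13), for the comparison field), `kernel_blockDiag_eq_zero_of_ne` (the zero-extended kernel of `c·B_bd` vanishes across
  the boxes: n08-b's `inv_blockDiag_apply_eq_zero`) — so the dominating measures of §3 are products over the boxes.
HONEST SCOPE.  Transport and assembly only — the estimates are seat n08-b's; the class is OUR reading of [Balaban1985BackgroundPropagators] p. 428, (5.13)'s substitute is OURS, not print; nothing of
[Balaban1985UV3] / [Balaban1985UV2] is asserted; no generalised Basic Lemma is stated; count-neutral for N08; nothing about d = 4, the continuum, OS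
axioms, a mass gap or the Clay problem.
-/

noncomputable section

open MeasureTheory ProbabilityTheory Finset Matrix WithLp
open scoped BigOperators Matrix NNReal ENNReal

namespace Literature.MathematicalPhysics.QuantumFieldTheory.Balaban1983to89.B1Eq324BenfattoKernelComparison

open Literature.MathematicalPhysics.QuantumFieldTheory
open Literature.MathematicalPhysics.QuantumFieldTheory.Balaban1983to89.B1Eq324BenfattoLemma
open Literature.MathematicalPhysics.QuantumFieldTheory.Balaban1983to89.B1Eq324BenfattoKernelRegression
open Literature.MathematicalPhysics.QuantumFieldTheory.Balaban1983to89.B1Eq324BenfattoKernelOfPrecision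
open Literature.MathematicalPhysics.QuantumFieldTheory.Balaban1983to89.B1Eq324BenfattoClassAppendixC
open Literature.MathematicalPhysics.QuantumFieldTheory.Balaban1983to89.B1Eq324BenfattoClassDecoupling

variable {d : ℕ}

/-! ## §1  Finite-window laws of the field, of a shifted field and of the conditioned field -/

section Marginals

variable {K : B1Eq324BenfattoLemma.Site d → B1Eq324BenfattoLemma.Site d → ℝ} (hK : IsPosSemidefKernel K)

/-- kernel: the shift `ζ ↦ u + ζ` by a fixed configuration is measurable. [folklore] -/
private theorem measurable_shift (u : B1Eq324BenfattoLemma.Site d → ℝ) :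
    Measurable fun (ζ : B1Eq324BenfattoLemma.Site d → ℝ) (x : B1Eq324BenfattoLemma.Site d) => u x + ζ x :=
  measurable_pi_lambda _ fun x => measurable_const.add (measurable_pi_apply x)

include hK

/-- **The finite-window law of the field**: for an observable `F` of the `I`-coordinates,
`∫⁻ F(z|_I) d𝒩(0,K) = ∫⁻ F dN(0, K_II)` — the marginal of the Kolmogorov field on `I` is the centred multivariate Gaussian with covariance
matrix `covGram K I` (`gaussianFieldOfKernel_map_restrict`), read on `EuclideanSpace ℝ I` through `ofLp`.
[cite: BenfattoEtAl1978, §1 p.144 «a family of gaussian random variables indexed by the tesserae» (class form)] -/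
theorem lintegral_comp_restrict_eq (I : Finset (B1Eq324BenfattoLemma.Site d)) {F : (I → ℝ) → ℝ≥0∞} (hF : Measurable F) :
    ∫⁻ z, F (I.restrict z) ∂gaussianFieldOfKernel K = ∫⁻ y, F (ofLp y) ∂multivariateGaussian 0 (covGram K I) := by
  rw [← lintegral_map hF (Finset.measurable_restrict I), gaussianFieldOfKernel_map_restrict hK I, gaussianFamilyOfKernel,
    lintegral_map_equiv]
  rfl

/-- **The finite-window law of the field, Bochner form** (real observables). [cite: BenfattoEtAl1978, §1 p.144 (class form)] -/
theorem integral_comp_restrict_eq (I : Finset (B1Eq324BenfattoLemma.Site d)) {f : (I → ℝ) → ℝ} (hf : Measurable f) :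
    ∫ z, f (I.restrict z) ∂gaussianFieldOfKernel K = ∫ y, f (ofLp y) ∂multivariateGaussian 0 (covGram K I) := by
  rw [← integral_map (Finset.measurable_restrict I).aemeasurable hf.aestronglyMeasurable, gaussianFieldOfKernel_map_restrict hK I,
    integral_gaussianFamilyOfKernel]

/-- **The finite-window law of a SHIFTED field**: for a fixed configuration `u`,
`∫⁻ F(z|_I) d[𝒩(0,K) ∘ (ζ ↦ u + ζ)⁻¹] = ∫⁻ F dN(u|_I, K_II)` — the marginal of the translated field is the multivariate Gaussian with mean
`u|_I` (n08-b's `multivariateGaussian_eq_map_add`). [cite: BenfattoEtAl1978, Appendix C 2) p.164 «a non centered gaussian field … and center u» (class form)] -/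
theorem lintegral_comp_restrict_shift_eq (u : B1Eq324BenfattoLemma.Site d → ℝ) (I : Finset (B1Eq324BenfattoLemma.Site d))
    {F : (I → ℝ) → ℝ≥0∞} (hF : Measurable F) :
    ∫⁻ z, F (I.restrict z) ∂((gaussianFieldOfKernel K).map
        fun (ζ : B1Eq324BenfattoLemma.Site d → ℝ) (x : B1Eq324BenfattoLemma.Site d) => u x + ζ x) =
      ∫⁻ y, F (ofLp y) ∂multivariateGaussian (toLp 2 (I.restrict u)) (covGram K I) := by
  have hofLp : Measurable (ofLp : EuclideanSpace ℝ I → (I → ℝ)) := (MeasurableEquiv.toLp 2 (I → ℝ)).symm.measurable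
  have hFv : Measurable fun v : I → ℝ => F (I.restrict u + v) := hF.comp (measurable_const_add _)
  calc ∫⁻ z, F (I.restrict z) ∂((gaussianFieldOfKernel K).map
          fun (ζ : B1Eq324BenfattoLemma.Site d → ℝ) (x : B1Eq324BenfattoLemma.Site d) => u x + ζ x)
      = ∫⁻ ζ, F (I.restrict u + I.restrict ζ) ∂gaussianFieldOfKernel K := by
        rw [lintegral_map (f := fun z : B1Eq324BenfattoLemma.Site d → ℝ => F (I.restrict z))
          (hF.comp (Finset.measurable_restrict I)) (measurable_shift u)]
        rfl
    _ = ∫⁻ v, F (I.restrict u + v) ∂((gaussianFieldOfKernel K).map I.restrict) := by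
        rw [lintegral_map (f := fun v : I → ℝ => F (I.restrict u + v)) hFv (Finset.measurable_restrict I)]
    _ = ∫⁻ y, F (I.restrict u + ofLp y) ∂multivariateGaussian 0 (covGram K I) := by
        rw [gaussianFieldOfKernel_map_restrict hK I, gaussianFamilyOfKernel, lintegral_map_equiv]
        rfl
    _ = ∫⁻ y, F (ofLp y) ∂multivariateGaussian (toLp 2 (I.restrict u)) (covGram K I) := by
        rw [multivariateGaussian_eq_map_add (toLp 2 (I.restrict u)) (covGram K I),
          lintegral_map (f := fun y : EuclideanSpace ℝ I => F (ofLp y)) (hF.comp hofLp) (measurable_const_add _)]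
        refine lintegral_congr fun y => ?_
        simp only [WithLp.ofLp_add]

/-- **The finite-window law of the CONDITIONED field** (`K_CC` invertible): for the conditioned field of `…KernelCondField`,
`∫⁻ F(z|_I) dP̄^K_{C,z̄} = ∫⁻ F dN(u_C(z̄)|_I, C^C_II)` — print's «non centered gaussian field with covariance C^Γ and center u» as a
finite-dimensional law. [cite: BenfattoEtAl1978, Appendix C 2) (C.6)–(C.7) p.164 (class form)] -/
theorem lintegral_comp_restrict_condFieldK_eq (C : Finset (B1Eq324BenfattoLemma.Site d)) (hC : IsUnit (covGram K C).det)
    (zbar : B1Eq324BenfattoLemma.Site d → ℝ) (I : Finset (B1Eq324BenfattoLemma.Site d)) {F : (I → ℝ) → ℝ≥0∞} (hF : Measurable F) :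
    ∫⁻ z, F (I.restrict z) ∂((gaussianFieldOfKernel (condCov K C)).map
        fun (ζ : B1Eq324BenfattoLemma.Site d → ℝ) (x : B1Eq324BenfattoLemma.Site d) => condMean K C zbar x + ζ x) =
      ∫⁻ y, F (ofLp y) ∂multivariateGaussian (toLp 2 (I.restrict (condMean K C zbar))) (covGram (condCov K C) I) :=
  lintegral_comp_restrict_shift_eq (isPosSemidefKernel_condCov K hK C hC) (condMean K C zbar) I hF

end Marginals

/-! ## §2  Seat n08-b's Gaussian domination transferred to the fields -/

section Domination

variable {K₁ K₂ : B1Eq324BenfattoLemma.Site d → B1Eq324BenfattoLemma.Site d → ℝ} (hK₁ : IsPosSemidefKernel K₁) (hK₂ : IsPosSemidefKernel K₂)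
  (I : Finset (B1Eq324BenfattoLemma.Site d)) {P₁ P₂ : Matrix I I ℝ} (hP₁ : P₁.PosDef) (hP₂ : P₂.PosDef) {δ : ℝ} (hδ0 : 0 ≤ δ) (hδ1 : δ < 1)
  (hlow : ∀ v : I → ℝ, (1 - δ) * (v ⬝ᵥ P₂ *ᵥ v) ≤ v ⬝ᵥ P₁ *ᵥ v)
  (hup : ∀ v : I → ℝ, v ⬝ᵥ P₁ *ᵥ v ≤ (1 + δ) * (v ⬝ᵥ P₂ *ᵥ v))

include hK₁ hK₂ hP₁ hP₂ hδ0 hδ1 hlow hup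

/-- **DOMINATION BETWEEN THE FIELDS, upper**: if the window Gram matrices are `K₁_II = P₁⁻¹` and `K₂_II = ((1−δ)P₂)⁻¹` for positive-definite
precisions with `(1−δ)⟨v,P₂v⟩ ≤ ⟨v,P₁v⟩ ≤ (1+δ)⟨v,P₂v⟩`, then for every measurable `F ≥ 0` of the `I`-coordinates
`∫⁻ F(z|_I) d𝒩(0,K₁) ≤ (√(1+δ)/√(1−δ))^{|I|} ∫⁻ F(z|_I) d𝒩(0,K₂)` (n08-b's `lintegral_multivariateGaussian_le_of_form_le` + §1).
[cite: BenfattoEtAl1978, §5 (5.13) p.155 (class substitute; ours)] -/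
theorem lintegral_restrict_le_of_form_le (h₁ : covGram K₁ I = P₁⁻¹) (h₂ : covGram K₂ I = ((1 - δ) • P₂)⁻¹)
    {F : (I → ℝ) → ℝ≥0∞} (hF : Measurable F) :
    ∫⁻ z, F (I.restrict z) ∂gaussianFieldOfKernel K₁ ≤
      ENNReal.ofReal ((Real.sqrt (1 + δ) / Real.sqrt (1 - δ)) ^ Fintype.card I) *
        ∫⁻ z, F (I.restrict z) ∂gaussianFieldOfKernel K₂ := by
  have hofLp : Measurable (ofLp : EuclideanSpace ℝ I → (I → ℝ)) := (MeasurableEquiv.toLp 2 (I → ℝ)).symm.measurable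
  rw [lintegral_comp_restrict_eq hK₁ I hF, lintegral_comp_restrict_eq hK₂ I hF, h₁, h₂]
  exact lintegral_multivariateGaussian_le_of_form_le hP₁ hP₂ hδ0 hδ1 hlow hup (fun y => F (ofLp y)) (hF.comp hofLp)

/-- **DOMINATION BETWEEN THE FIELDS, lower**: under the same form bounds with `K₂_II = ((1+δ)P₂)⁻¹`,
`(√(1−δ)/√(1+δ))^{|I|} ∫⁻ F(z|_I) d𝒩(0,K₂) ≤ ∫⁻ F(z|_I) d𝒩(0,K₁)`. [cite: BenfattoEtAl1978, §5 (5.13) p.155 (class substitute; ours)] -/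
theorem lintegral_restrict_ge_of_form_le (h₁ : covGram K₁ I = P₁⁻¹) (h₂ : covGram K₂ I = ((1 + δ) • P₂)⁻¹)
    {F : (I → ℝ) → ℝ≥0∞} (hF : Measurable F) :
    ENNReal.ofReal ((Real.sqrt (1 - δ) / Real.sqrt (1 + δ)) ^ Fintype.card I) *
        ∫⁻ z, F (I.restrict z) ∂gaussianFieldOfKernel K₂ ≤
      ∫⁻ z, F (I.restrict z) ∂gaussianFieldOfKernel K₁ := by
  have hofLp : Measurable (ofLp : EuclideanSpace ℝ I → (I → ℝ)) := (MeasurableEquiv.toLp 2 (I → ℝ)).symm.measurable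
  rw [lintegral_comp_restrict_eq hK₁ I hF, lintegral_comp_restrict_eq hK₂ I hF, h₁, h₂]
  exact lintegral_multivariateGaussian_ge_of_form_le hP₁ hP₂ hδ0 hδ1 hlow hup (fun y => F (ofLp y)) (hF.comp hofLp)

/-- **DOMINATION BETWEEN THE SHIFTED FIELDS (common centre), upper** — the form the conditioned fields of the chain need (centre
`u = u_Γ(z̄)`, `K₁ = C^Γ` with `C^Γ_II = (A|_{Λ∖Γ})⁻¹`, `K₂` the block-diagonal comparison kernel):
`∫⁻ F(z|_I) d[𝒩(0,K₁)∘(u+·)⁻¹] ≤ (√(1+δ)/√(1−δ))^{|I|} ∫⁻ F(z|_I) d[𝒩(0,K₂)∘(u+·)⁻¹]`.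
[cite: BenfattoEtAl1978, §5 (5.13) p.155, (5.36) p.159 (class substitute; ours)] -/
theorem lintegral_restrict_shift_le_of_form_le (h₁ : covGram K₁ I = P₁⁻¹) (h₂ : covGram K₂ I = ((1 - δ) • P₂)⁻¹)
    (u : B1Eq324BenfattoLemma.Site d → ℝ) {F : (I → ℝ) → ℝ≥0∞} (hF : Measurable F) :
    ∫⁻ z, F (I.restrict z) ∂((gaussianFieldOfKernel K₁).map
        fun (ζ : B1Eq324BenfattoLemma.Site d → ℝ) (x : B1Eq324BenfattoLemma.Site d) => u x + ζ x) ≤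
      ENNReal.ofReal ((Real.sqrt (1 + δ) / Real.sqrt (1 - δ)) ^ Fintype.card I) *
        ∫⁻ z, F (I.restrict z) ∂((gaussianFieldOfKernel K₂).map
          fun (ζ : B1Eq324BenfattoLemma.Site d → ℝ) (x : B1Eq324BenfattoLemma.Site d) => u x + ζ x) := by
  have hofLp : Measurable (ofLp : EuclideanSpace ℝ I → (I → ℝ)) := (MeasurableEquiv.toLp 2 (I → ℝ)).symm.measurable
  rw [lintegral_comp_restrict_shift_eq hK₁ u I hF, lintegral_comp_restrict_shift_eq hK₂ u I hF, h₁, h₂]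
  exact lintegral_multivariateGaussian_mean_le_of_form_le hP₁ hP₂ hδ0 hδ1 hlow hup _ (fun y => F (ofLp y)) (hF.comp hofLp)

/-- **DOMINATION BETWEEN THE SHIFTED FIELDS (common centre), lower.**
[cite: BenfattoEtAl1978, §5 (5.13) p.155, (5.36) p.159 (class substitute; ours)] -/
theorem lintegral_restrict_shift_ge_of_form_le (h₁ : covGram K₁ I = P₁⁻¹) (h₂ : covGram K₂ I = ((1 + δ) • P₂)⁻¹)
    (u : B1Eq324BenfattoLemma.Site d → ℝ) {F : (I → ℝ) → ℝ≥0∞} (hF : Measurable F) :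
    ENNReal.ofReal ((Real.sqrt (1 - δ) / Real.sqrt (1 + δ)) ^ Fintype.card I) *
        ∫⁻ z, F (I.restrict z) ∂((gaussianFieldOfKernel K₂).map
          fun (ζ : B1Eq324BenfattoLemma.Site d → ℝ) (x : B1Eq324BenfattoLemma.Site d) => u x + ζ x) ≤
      ∫⁻ z, F (I.restrict z) ∂((gaussianFieldOfKernel K₁).map
        fun (ζ : B1Eq324BenfattoLemma.Site d → ℝ) (x : B1Eq324BenfattoLemma.Site d) => u x + ζ x) := by
  have hofLp : Measurable (ofLp : EuclideanSpace ℝ I → (I → ℝ)) := (MeasurableEquiv.toLp 2 (I → ℝ)).symm.measurable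
  rw [lintegral_comp_restrict_shift_eq hK₁ u I hF, lintegral_comp_restrict_shift_eq hK₂ u I hF, h₁, h₂]
  exact lintegral_multivariateGaussian_mean_ge_of_form_le hP₁ hP₂ hδ0 hδ1 hlow hup _ (fun y => F (ofLp y)) (hF.comp hofLp)

end Domination

/-! ## §3  Assembly for the precision class: the conditioned class field versus the block-diagonal comparison field -/

section PrecisionClass

variable {Λ : Finset (B1Eq324BenfattoLemma.Site d)} {A : Matrix Λ Λ ℝ} {K : B1Eq324BenfattoLemma.Site d → B1Eq324BenfattoLemma.Site d → ℝ}
  (hK : ∀ x y, K x y = if h : x ∈ Λ ∧ y ∈ Λ then (A⁻¹ : Matrix Λ Λ ℝ) ⟨x, h.1⟩ ⟨y, h.2⟩ else 0)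

/-- kernel: a sum over `↥Λ` of a function supported on the image of `Λ ∖ Γ` is the sum over `↥(Λ ∖ Γ)`. [folklore] -/
private theorem sum_dite_sdiff (Γ : Finset (B1Eq324BenfattoLemma.Site d)) (g : ↥(Λ \ Γ) → ℝ) :
    ∑ j : Λ, (if h : (j : B1Eq324BenfattoLemma.Site d) ∈ Λ \ Γ then g ⟨j, h⟩ else 0) = ∑ y : ↥(Λ \ Γ), g y := by
  classical
  have key : ∀ φ : B1Eq324BenfattoLemma.Site d → ℝ, (∀ s, s ∉ Λ \ Γ → φ s = 0) → ∑ j : Λ, φ j = ∑ y : ↥(Λ \ Γ), φ y := by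
    intro φ hφ0
    rw [Finset.sum_coe_sort Λ φ, ← Finset.sum_subset Finset.sdiff_subset (fun s _ hs => hφ0 s hs), Finset.sum_coe_sort]
  rw [key (fun s => if h : s ∈ Λ \ Γ then g ⟨s, h⟩ else 0) (fun s hs => dif_neg hs)]
  exact Finset.sum_congr rfl fun y _ => dif_pos y.2

/-- **The precision block `A|_{Λ∖Γ}` inherits coercivity** (extend a test vector by zero). [cite: HornJohnson2013, Thm 4.3.28 (principal submatrices)] -/
theorem coercive_submatrix_sdiff {γ : ℝ} (hγ : ∀ x : Λ → ℝ, γ * ∑ e, x e ^ 2 ≤ ∑ e, ∑ e', A e e' * x e * x e') (Γ : Finset (B1Eq324BenfattoLemma.Site d))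
    (v : ↥(Λ \ Γ) → ℝ) :
    γ * ∑ y, v y ^ 2 ≤ ∑ y, ∑ y',
      A.submatrix (fun j : ↥(Λ \ Γ) => (⟨j, (Finset.mem_sdiff.mp j.2).1⟩ : Λ))
        (fun j : ↥(Λ \ Γ) => (⟨j, (Finset.mem_sdiff.mp j.2).1⟩ : Λ)) y y' * v y * v y' := by
  classical
  simp only [Matrix.submatrix_apply]
  -- the zero extension of `v` to `Λ`
  let x : Λ → ℝ := fun j => if h : (j : B1Eq324BenfattoLemma.Site d) ∈ Λ \ Γ then v ⟨j, h⟩ else 0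
  have hxdef : ∀ j : Λ, x j = if h : (j : B1Eq324BenfattoLemma.Site d) ∈ Λ \ Γ then v ⟨j, h⟩ else 0 := fun j => rfl
  have hsq : ∑ e, x e ^ 2 = ∑ y, v y ^ 2 := by
    rw [← sum_dite_sdiff Γ (fun y => v y ^ 2)]
    refine Finset.sum_congr rfl fun j _ => ?_
    rw [hxdef j]
    by_cases h : (j : B1Eq324BenfattoLemma.Site d) ∈ Λ \ Γ
    · rw [dif_pos h, dif_pos h]
    · rw [dif_neg h, dif_neg h]
      ring
  have hinner : ∀ e : Λ, ∑ e', A e e' * x e * x e' =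
      ∑ y' : ↥(Λ \ Γ), A e ⟨y', (Finset.mem_sdiff.mp y'.2).1⟩ * x e * v y' := by
    intro e
    rw [← sum_dite_sdiff Γ (fun y' => A e ⟨y', (Finset.mem_sdiff.mp y'.2).1⟩ * x e * v y')]
    refine Finset.sum_congr rfl fun j _ => ?_
    rw [hxdef j]
    by_cases h : (j : B1Eq324BenfattoLemma.Site d) ∈ Λ \ Γ
    · rw [dif_pos h, dif_pos h]
    · rw [dif_neg h, dif_neg h]
      ring
  have hform : ∑ e, ∑ e', A e e' * x e * x e' =
      ∑ y : ↥(Λ \ Γ), ∑ y' : ↥(Λ \ Γ),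
        A ⟨y, (Finset.mem_sdiff.mp y.2).1⟩ ⟨y', (Finset.mem_sdiff.mp y'.2).1⟩ * v y * v y' := by
    rw [Finset.sum_congr rfl fun e _ => hinner e,
      ← sum_dite_sdiff Γ (fun y => ∑ y' : ↥(Λ \ Γ),
        A ⟨y, (Finset.mem_sdiff.mp y.2).1⟩ ⟨y', (Finset.mem_sdiff.mp y'.2).1⟩ * v y * v y')]
    refine Finset.sum_congr rfl fun j _ => ?_
    by_cases h : (j : B1Eq324BenfattoLemma.Site d) ∈ Λ \ Γ
    · rw [dif_pos h]
      refine Finset.sum_congr rfl fun y' _ => ?_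
      rw [hxdef j, dif_pos h]
    · rw [dif_neg h]
      refine Finset.sum_eq_zero fun y' _ => ?_
      rw [hxdef j, dif_neg h]
      ring
  have h := hγ x
  rwa [hsq, hform] at h

/-- **The precision block `A|_{Λ∖Γ}` inherits the weighted row bound** (a sub-sum of non-negative terms).
[cite: HornJohnson2013, Thm 4.3.28 (principal submatrices)] -/
theorem rowSum_submatrix_sdiff_le {dist : B1Eq324BenfattoLemma.Site d → B1Eq324BenfattoLemma.Site d → ℝ} {κ' M₂ : ℝ}
    (hM : ∀ e : Λ, ∑ e' : Λ, |A e e'| * Real.exp (κ' * dist e e') ≤ M₂) (Γ : Finset (B1Eq324BenfattoLemma.Site d)) (y : ↥(Λ \ Γ)) :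
    ∑ y' : ↥(Λ \ Γ), |A.submatrix (fun j : ↥(Λ \ Γ) => (⟨j, (Finset.mem_sdiff.mp j.2).1⟩ : Λ))
        (fun j : ↥(Λ \ Γ) => (⟨j, (Finset.mem_sdiff.mp j.2).1⟩ : Λ)) y y'| * Real.exp (κ' * dist y y') ≤ M₂ := by
  classical
  refine le_trans ?_ (hM ⟨y, (Finset.mem_sdiff.mp y.2).1⟩)
  set g : Λ → ℝ := fun e' => |A ⟨y, (Finset.mem_sdiff.mp y.2).1⟩ e'| * Real.exp (κ' * dist y e') with hg
  have hgnn : ∀ e', 0 ≤ g e' := fun e' => mul_nonneg (abs_nonneg _) (Real.exp_pos _).le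
  calc ∑ y' : ↥(Λ \ Γ), |A.submatrix (fun j : ↥(Λ \ Γ) => (⟨j, (Finset.mem_sdiff.mp j.2).1⟩ : Λ))
          (fun j : ↥(Λ \ Γ) => (⟨j, (Finset.mem_sdiff.mp j.2).1⟩ : Λ)) y y'| * Real.exp (κ' * dist y y')
      = ∑ y' : ↥(Λ \ Γ), g ⟨y', (Finset.mem_sdiff.mp y'.2).1⟩ := Finset.sum_congr rfl fun y' _ => rfl
    _ = ∑ j : Λ, (if h : (j : B1Eq324BenfattoLemma.Site d) ∈ Λ \ Γ then g ⟨(⟨j, h⟩ : ↥(Λ \ Γ)), (Finset.mem_sdiff.mp h).1⟩ else 0) :=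
        (sum_dite_sdiff Γ (fun y' => g ⟨y', (Finset.mem_sdiff.mp y'.2).1⟩)).symm
    _ ≤ ∑ j : Λ, g j := Finset.sum_le_sum fun j _ => by
        by_cases h : (j : B1Eq324BenfattoLemma.Site d) ∈ Λ \ Γ
        · rw [dif_pos h]
        · rw [dif_neg h]; exact hgnn j

include hK

/-- **THE DECOUPLING ESTIMATE ON THE CONDITIONED CLASS FIELD, upper** — the substitute for (5.13) «the integral factorizes» at an exponentially
decaying (non-Markov) precision, delivered on the measure the §5 chain integrates against.  Setting: the class kernel `K` of a symmetric
`γ`-coercive precision `A` on `Λ` with weighted row bound `Σ_{e′}|A e e′|e^{κ′·dist e e′} ≤ M₂`; a conditioning set `Γ ⊆ Λ` (the corridors);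
a partition `π` of `Λ ∖ Γ` into parts («boxes») pairwise at `dist ≥ w` with `δ := M₂e^{−κ′w}/γ < 1`; and ANY positive-semidefinite comparison
kernel `K₂` whose Gram matrix on `Λ ∖ Γ` is `((1−δ)·(A|_{Λ∖Γ})_bd)⁻¹` (the box-block-diagonal Dirichlet precision at temperature `1−δ`; e.g. its
zero extension, `…KernelOfPrecision`).  Then for every measurable `F ≥ 0` of the `Λ ∖ Γ`-coordinates,
`∫⁻ F dP̄^K_{Γ,z̄} ≤ (√(1+δ)/√(1−δ))^{|Λ∖Γ|} ∫⁻ F d[𝒩(0,K₂) ∘ (u_Γ(z̄) + ·)⁻¹]` — n08-b's `decoupling` form bounds + §2 + the Dirichlet Gram identity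
`…KernelOfPrecision.covGram_condCov_kernel_eq_inv_submatrix`. [cite: BenfattoEtAl1978, §5 (5.13) p.155, (5.36) p.159 (class substitute; ours)] -/
theorem lintegral_restrict_condFieldK_le_blockDiag {σ : Type*} [Fintype σ] [DecidableEq σ]
    (hAs : ∀ e e', A e e' = A e' e) {dist : B1Eq324BenfattoLemma.Site d → B1Eq324BenfattoLemma.Site d → ℝ} {γ κ' w M₂ : ℝ}
    (hγ0 : 0 < γ) (hκ : 0 ≤ κ') (hM₂ : 0 ≤ M₂)
    (hγ : ∀ x : Λ → ℝ, γ * ∑ e, x e ^ 2 ≤ ∑ e, ∑ e', A e e' * x e * x e')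
    (hM : ∀ e : Λ, ∑ e' : Λ, |A e e'| * Real.exp (κ' * dist e e') ≤ M₂)
    {Γ : Finset (B1Eq324BenfattoLemma.Site d)} (hΓ : Γ ⊆ Λ) (π : ↥(Λ \ Γ) → σ) (hsep : ∀ y y' : ↥(Λ \ Γ), π y ≠ π y' → w ≤ dist y y')
    (hδ1 : M₂ * Real.exp (-(κ' * w)) < γ) (zbar : B1Eq324BenfattoLemma.Site d → ℝ)
    {K₂ : B1Eq324BenfattoLemma.Site d → B1Eq324BenfattoLemma.Site d → ℝ} (hK₂ : IsPosSemidefKernel K₂)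
    (h₂ : covGram K₂ (Λ \ Γ) = ((1 - M₂ * Real.exp (-(κ' * w)) / γ) •
      (Matrix.of fun y y' : ↥(Λ \ Γ) => if π y = π y' then
        A ⟨y, (Finset.mem_sdiff.mp y.2).1⟩ ⟨y', (Finset.mem_sdiff.mp y'.2).1⟩ else 0))⁻¹)
    {F : (↥(Λ \ Γ) → ℝ) → ℝ≥0∞} (hF : Measurable F) :
    ∫⁻ z, F ((Λ \ Γ).restrict z) ∂((gaussianFieldOfKernel (condCov K Γ)).map
        fun (ζ : B1Eq324BenfattoLemma.Site d → ℝ) (x : B1Eq324BenfattoLemma.Site d) => condMean K Γ zbar x + ζ x) ≤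
      ENNReal.ofReal ((Real.sqrt (1 + M₂ * Real.exp (-(κ' * w)) / γ) / Real.sqrt (1 - M₂ * Real.exp (-(κ' * w)) / γ)) ^
          Fintype.card ↥(Λ \ Γ)) *
        ∫⁻ z, F ((Λ \ Γ).restrict z) ∂((gaussianFieldOfKernel K₂).map
          fun (ζ : B1Eq324BenfattoLemma.Site d → ℝ) (x : B1Eq324BenfattoLemma.Site d) => condMean K Γ zbar x + ζ x) := by
  classical
  set B : Matrix ↥(Λ \ Γ) ↥(Λ \ Γ) ℝ := A.submatrix (fun j : ↥(Λ \ Γ) => (⟨j, (Finset.mem_sdiff.mp j.2).1⟩ : Λ))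
    (fun j : ↥(Λ \ Γ) => (⟨j, (Finset.mem_sdiff.mp j.2).1⟩ : Λ)) with hB
  have hBs : ∀ y y', B y y' = B y' y := fun y y' => hAs _ _
  have hBγ : ∀ v : ↥(Λ \ Γ) → ℝ, γ * ∑ y, v y ^ 2 ≤ ∑ y, ∑ y', B y y' * v y * v y' := coercive_submatrix_sdiff hγ Γ
  have hBM : ∀ y : ↥(Λ \ Γ), ∑ y', |B y y'| * Real.exp (κ' * dist y y') ≤ M₂ := rowSum_submatrix_sdiff_le hM Γ
  have hdec := decoupling hBs π hγ0 hκ hM₂ hBγ hBM hsep hδ1 (fun _ => 0) measurable_const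
  have htwo := hdec.1
  have hA : A.PosDef := posDef_of_coercive hAs hγ0 hγ
  have hP₁ : B.PosDef := posDef_submatrix_sdiff (A := A) hA Γ
  have hP₂ : (Matrix.of fun y y' : ↥(Λ \ Γ) => if π y = π y' then B y y' else 0 : Matrix ↥(Λ \ Γ) ↥(Λ \ Γ) ℝ).PosDef :=
    posDef_blockDiag hBs π hγ0 hBγ
  have hδ0 : 0 ≤ M₂ * Real.exp (-(κ' * w)) / γ := by positivity
  have hδ1' : M₂ * Real.exp (-(κ' * w)) / γ < 1 := by rw [div_lt_one hγ0]; exact hδ1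
  have h₁ : covGram (condCov K Γ) (Λ \ Γ) = B⁻¹ := covGram_condCov_kernel_eq_inv_submatrix hK hA hΓ
  have hdetΓ : IsUnit (covGram K Γ).det := isUnit_det_covGram_kernel hK hA hΓ
  have hBbd : (Matrix.of fun y y' : ↥(Λ \ Γ) => if π y = π y' then
        A ⟨y, (Finset.mem_sdiff.mp y.2).1⟩ ⟨y', (Finset.mem_sdiff.mp y'.2).1⟩ else 0) =
      (Matrix.of fun y y' : ↥(Λ \ Γ) => if π y = π y' then B y y' else 0 : Matrix ↥(Λ \ Γ) ↥(Λ \ Γ) ℝ) := by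
    ext y y'
    simp only [Matrix.of_apply, hB, Matrix.submatrix_apply]
  rw [hBbd] at h₂
  exact lintegral_restrict_shift_le_of_form_le (isPosSemidefKernel_condCov K (isPosSemidefKernel_kernel hK hA) Γ hdetΓ) hK₂ (Λ \ Γ)
    hP₁ hP₂ hδ0 hδ1' (fun v => (htwo v).1) (fun v => (htwo v).2) h₁ h₂ (condMean K Γ zbar) hF

/-- **THE DECOUPLING ESTIMATE ON THE CONDITIONED CLASS FIELD, lower** (comparison kernel at temperature `1+δ`).
[cite: BenfattoEtAl1978, §5 (5.13) p.155, (5.36) p.159 (class substitute; ours)] -/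
theorem lintegral_restrict_condFieldK_ge_blockDiag {σ : Type*} [Fintype σ] [DecidableEq σ]
    (hAs : ∀ e e', A e e' = A e' e) {dist : B1Eq324BenfattoLemma.Site d → B1Eq324BenfattoLemma.Site d → ℝ} {γ κ' w M₂ : ℝ}
    (hγ0 : 0 < γ) (hκ : 0 ≤ κ') (hM₂ : 0 ≤ M₂)
    (hγ : ∀ x : Λ → ℝ, γ * ∑ e, x e ^ 2 ≤ ∑ e, ∑ e', A e e' * x e * x e')
    (hM : ∀ e : Λ, ∑ e' : Λ, |A e e'| * Real.exp (κ' * dist e e') ≤ M₂)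
    {Γ : Finset (B1Eq324BenfattoLemma.Site d)} (hΓ : Γ ⊆ Λ) (π : ↥(Λ \ Γ) → σ) (hsep : ∀ y y' : ↥(Λ \ Γ), π y ≠ π y' → w ≤ dist y y')
    (hδ1 : M₂ * Real.exp (-(κ' * w)) < γ) (zbar : B1Eq324BenfattoLemma.Site d → ℝ)
    {K₂ : B1Eq324BenfattoLemma.Site d → B1Eq324BenfattoLemma.Site d → ℝ} (hK₂ : IsPosSemidefKernel K₂)
    (h₂ : covGram K₂ (Λ \ Γ) = ((1 + M₂ * Real.exp (-(κ' * w)) / γ) •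
      (Matrix.of fun y y' : ↥(Λ \ Γ) => if π y = π y' then
        A ⟨y, (Finset.mem_sdiff.mp y.2).1⟩ ⟨y', (Finset.mem_sdiff.mp y'.2).1⟩ else 0))⁻¹)
    {F : (↥(Λ \ Γ) → ℝ) → ℝ≥0∞} (hF : Measurable F) :
    ENNReal.ofReal ((Real.sqrt (1 - M₂ * Real.exp (-(κ' * w)) / γ) / Real.sqrt (1 + M₂ * Real.exp (-(κ' * w)) / γ)) ^
          Fintype.card ↥(Λ \ Γ)) *
        ∫⁻ z, F ((Λ \ Γ).restrict z) ∂((gaussianFieldOfKernel K₂).map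
          fun (ζ : B1Eq324BenfattoLemma.Site d → ℝ) (x : B1Eq324BenfattoLemma.Site d) => condMean K Γ zbar x + ζ x) ≤
      ∫⁻ z, F ((Λ \ Γ).restrict z) ∂((gaussianFieldOfKernel (condCov K Γ)).map
        fun (ζ : B1Eq324BenfattoLemma.Site d → ℝ) (x : B1Eq324BenfattoLemma.Site d) => condMean K Γ zbar x + ζ x) := by
  classical
  set B : Matrix ↥(Λ \ Γ) ↥(Λ \ Γ) ℝ := A.submatrix (fun j : ↥(Λ \ Γ) => (⟨j, (Finset.mem_sdiff.mp j.2).1⟩ : Λ))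
    (fun j : ↥(Λ \ Γ) => (⟨j, (Finset.mem_sdiff.mp j.2).1⟩ : Λ)) with hB
  have hBs : ∀ y y', B y y' = B y' y := fun y y' => hAs _ _
  have hBγ : ∀ v : ↥(Λ \ Γ) → ℝ, γ * ∑ y, v y ^ 2 ≤ ∑ y, ∑ y', B y y' * v y * v y' := coercive_submatrix_sdiff hγ Γ
  have hBM : ∀ y : ↥(Λ \ Γ), ∑ y', |B y y'| * Real.exp (κ' * dist y y') ≤ M₂ := rowSum_submatrix_sdiff_le hM Γ
  have hdec := decoupling hBs π hγ0 hκ hM₂ hBγ hBM hsep hδ1 (fun _ => 0) measurable_const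
  have htwo := hdec.1
  have hA : A.PosDef := posDef_of_coercive hAs hγ0 hγ
  have hP₁ : B.PosDef := posDef_submatrix_sdiff (A := A) hA Γ
  have hP₂ : (Matrix.of fun y y' : ↥(Λ \ Γ) => if π y = π y' then B y y' else 0 : Matrix ↥(Λ \ Γ) ↥(Λ \ Γ) ℝ).PosDef :=
    posDef_blockDiag hBs π hγ0 hBγ
  have hδ0 : 0 ≤ M₂ * Real.exp (-(κ' * w)) / γ := by positivity
  have hδ1' : M₂ * Real.exp (-(κ' * w)) / γ < 1 := by rw [div_lt_one hγ0]; exact hδ1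
  have h₁ : covGram (condCov K Γ) (Λ \ Γ) = B⁻¹ := covGram_condCov_kernel_eq_inv_submatrix hK hA hΓ
  have hdetΓ : IsUnit (covGram K Γ).det := isUnit_det_covGram_kernel hK hA hΓ
  have hBbd : (Matrix.of fun y y' : ↥(Λ \ Γ) => if π y = π y' then
        A ⟨y, (Finset.mem_sdiff.mp y.2).1⟩ ⟨y', (Finset.mem_sdiff.mp y'.2).1⟩ else 0) =
      (Matrix.of fun y y' : ↥(Λ \ Γ) => if π y = π y' then B y y' else 0 : Matrix ↥(Λ \ Γ) ↥(Λ \ Γ) ℝ) := by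
    ext y y'
    simp only [Matrix.of_apply, hB, Matrix.submatrix_apply]
  rw [hBbd] at h₂
  exact lintegral_restrict_shift_ge_of_form_le (isPosSemidefKernel_condCov K (isPosSemidefKernel_kernel hK hA) Γ hdetΓ) hK₂ (Λ \ Γ)
    hP₁ hP₂ hδ0 hδ1' (fun v => (htwo v).1) (fun v => (htwo v).2) h₁ h₂ (condMean K Γ zbar) hF

end PrecisionClass

/-! ## §4  The comparison field FACTORISES over the boxes: independence under a shifted field with block-diagonal kernel -/

section Factorisation

variable {K : B1Eq324BenfattoLemma.Site d → B1Eq324BenfattoLemma.Site d → ℝ} (hK : IsPosSemidefKernel K)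

include hK

/-- **Under a SHIFTED Gaussian field the coordinates form a (non-centred) Gaussian field.**
[cite: BenfattoEtAl1978, Appendix C 2) p.164 «a non centered gaussian field … and center u» (class form)] -/
theorem isGaussianProcess_shift (u : B1Eq324BenfattoLemma.Site d → ℝ) :
    IsGaussianProcess (fun (x : B1Eq324BenfattoLemma.Site d) (z : B1Eq324BenfattoLemma.Site d → ℝ) => z x)
      ((gaussianFieldOfKernel K).map fun (ζ : B1Eq324BenfattoLemma.Site d → ℝ) (x : B1Eq324BenfattoLemma.Site d) => u x + ζ x) := by
  classical
  set Q := gaussianFieldOfKernel K with hQ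
  haveI := isProbabilityMeasure_gaussianFieldOfKernel hK
  set T : (B1Eq324BenfattoLemma.Site d → ℝ) → (B1Eq324BenfattoLemma.Site d → ℝ) := fun ζ x => u x + ζ x with hT
  have hTm : Measurable T := measurable_shift u
  change IsGaussianProcess _ (Q.map T)
  refine ⟨fun I => ?_⟩
  have hG : HasGaussianLaw (fun ζ : B1Eq324BenfattoLemma.Site d → ℝ => I.restrict ζ) Q := (isGaussianProcess_eval_gaussianFieldOfKernel hK).hasGaussianLaw I
  have hrm : Measurable (fun z : B1Eq324BenfattoLemma.Site d → ℝ => I.restrict z) := Finset.measurable_restrict I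
  have hcomp : (fun z : B1Eq324BenfattoLemma.Site d → ℝ => I.restrict z) ∘ T = (fun v : I → ℝ => I.restrict u + v) ∘ fun ζ => I.restrict ζ := by
    funext ζ
    ext i
    simp only [Function.comp_apply, Finset.restrict, hT, Pi.add_apply]
  have hshift : Measurable fun v : I → ℝ => I.restrict u + v := measurable_const.add measurable_id
  refine ⟨?_⟩
  rw [Measure.map_map hrm hTm]
  change IsGaussian (Q.map ((fun z : B1Eq324BenfattoLemma.Site d → ℝ => I.restrict z) ∘ T))
  rw [hcomp, ← Measure.map_map hshift hrm]
  haveI : IsGaussian (Q.map fun ζ : B1Eq324BenfattoLemma.Site d → ℝ => I.restrict ζ) := hG.isGaussian_map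
  infer_instance

/-- **The covariance of a shifted field is the kernel**: `Cov(z_x, z_y) = K(x,y)` under `𝒩(0,K) ∘ (u + ·)⁻¹`.
[cite: BenfattoEtAl1978, Appendix C 2) (C.6) p.164 (class form)] -/
theorem covariance_eval_shift (u : B1Eq324BenfattoLemma.Site d → ℝ) (x y : B1Eq324BenfattoLemma.Site d) :
    cov[fun z => z x, fun z => z y; (gaussianFieldOfKernel K).map fun (ζ : B1Eq324BenfattoLemma.Site d → ℝ) (x : B1Eq324BenfattoLemma.Site d) => u x + ζ x] = K x y := by
  set Q := gaussianFieldOfKernel K with hQ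
  haveI := isProbabilityMeasure_gaussianFieldOfKernel hK
  set T : (B1Eq324BenfattoLemma.Site d → ℝ) → (B1Eq324BenfattoLemma.Site d → ℝ) := fun ζ x => u x + ζ x with hT
  have hTm : Measurable T := measurable_shift u
  change cov[fun z => z x, fun z => z y; Q.map T] = _
  rw [covariance_map (measurable_pi_apply x).aestronglyMeasurable (measurable_pi_apply y).aestronglyMeasurable hTm.aemeasurable]
  have hix : Integrable (fun ζ : B1Eq324BenfattoLemma.Site d → ℝ => ζ x) Q := ((isGaussianProcess_eval_gaussianFieldOfKernel hK).hasGaussianLaw_eval x).integrable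
  have hiy : Integrable (fun ζ : B1Eq324BenfattoLemma.Site d → ℝ => ζ y) Q := ((isGaussianProcess_eval_gaussianFieldOfKernel hK).hasGaussianLaw_eval y).integrable
  change cov[fun ζ => u x + ζ x, fun ζ => u y + ζ y; Q] = _
  rw [covariance_const_add_left hix, covariance_const_add_right hiy, covariance_eval_gaussianFieldOfKernel hK x y]

/-- **MUTUAL INDEPENDENCE OF `K`-DECOUPLED REGIONS UNDER A SHIFTED FIELD**: if `K s t = 0` whenever `s ∈ Ω_i`, `t ∈ Ω_j`, `i ≠ j`, then the
coordinate families `((z_x)_{x∈Ω_i})_i` are mutually independent under `𝒩(0,K) ∘ (u + ·)⁻¹` for every deterministic shift `u` — «the integral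
factorizes» for the comparison field of the decoupling estimate. [cite: BenfattoEtAl1978, §5 (5.13) p.155; p.153 «factorize “over the boxes □”» (class substitute; ours)] -/
theorem iIndepFun_shift_of_kernel_eq_zero {ι : Type*} {Ω : ι → Set (B1Eq324BenfattoLemma.Site d)}
    (hvan : ∀ i j, i ≠ j → ∀ s ∈ Ω i, ∀ t ∈ Ω j, K s t = 0) (u : B1Eq324BenfattoLemma.Site d → ℝ) :
    iIndepFun (fun i (z : B1Eq324BenfattoLemma.Site d → ℝ) (s : Ω i) => z s)
      ((gaussianFieldOfKernel K).map fun (ζ : B1Eq324BenfattoLemma.Site d → ℝ) (x : B1Eq324BenfattoLemma.Site d) => u x + ζ x) := by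
  have hG := isGaussianProcess_shift hK u
  set P := (gaussianFieldOfKernel K).map fun (ζ : B1Eq324BenfattoLemma.Site d → ℝ) (x : B1Eq324BenfattoLemma.Site d) => u x + ζ x with hP
  have hX : IsGaussianProcess (fun (p : (i : ι) × Ω i) (z : B1Eq324BenfattoLemma.Site d → ℝ) => z (p.2 : B1Eq324BenfattoLemma.Site d)) P :=
    hG.comp_right (fun p : (i : ι) × Ω i => (p.2 : B1Eq324BenfattoLemma.Site d))
  refine IsGaussianProcess.iIndepFun_of_covariance_eq_zero (X := fun i (s : Ω i) (z : B1Eq324BenfattoLemma.Site d → ℝ) => z s) hX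
    (fun i s => (measurable_pi_apply _).aemeasurable) fun i j hij s t => ?_
  rw [hP, covariance_eval_shift hK u]
  exact hvan i j hij s s.2 t t.2

/-- **THE INTEGRAL FACTORIZES under the comparison field**: for finitely many pairwise `K`-decoupled regions and observables `f_i` of the
fields in them, `∫ Π_i f_i(z|_{Ω_i}) d[𝒩(0,K)∘(u+·)⁻¹] = Π_i ∫ f_i(z|_{Ω_i}) d[𝒩(0,K)∘(u+·)⁻¹]` — print's (5.13) product over the boxes, here for
the block-diagonal comparison field of `lintegral_restrict_condFieldK_le_blockDiag` (whose kernel vanishes across boxes: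
`…ClassDecoupling.inv_blockDiag_apply_eq_zero` + `…KernelOfPrecision.kernel_apply_of_mem`). [cite: BenfattoEtAl1978, §5 (5.13) p.155 (class substitute; ours)] -/
theorem integral_prod_eq_prod_integral_shift {ι : Type*} [Fintype ι] {Ω : ι → Set (B1Eq324BenfattoLemma.Site d)}
    (hvan : ∀ i j, i ≠ j → ∀ s ∈ Ω i, ∀ t ∈ Ω j, K s t = 0) (u : B1Eq324BenfattoLemma.Site d → ℝ)
    (f : (i : ι) → ((Ω i) → ℝ) → ℝ) (hf : ∀ i, Measurable (f i)) :
    ∫ z, ∏ i, f i (fun s : Ω i => z s) ∂((gaussianFieldOfKernel K).map fun (ζ : B1Eq324BenfattoLemma.Site d → ℝ) (x : B1Eq324BenfattoLemma.Site d) => u x + ζ x)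
      = ∏ i, ∫ z, f i (fun s : Ω i => z s) ∂((gaussianFieldOfKernel K).map fun (ζ : B1Eq324BenfattoLemma.Site d → ℝ) (x : B1Eq324BenfattoLemma.Site d) => u x + ζ x) := by
  have hXm : ∀ i, Measurable fun (z : B1Eq324BenfattoLemma.Site d → ℝ) (s : Ω i) => z s :=
    fun i => measurable_pi_lambda _ fun s => measurable_pi_apply _
  exact (iIndepFun_shift_of_kernel_eq_zero hK hvan u).integral_fun_prod_comp
    (fun i => (hXm i).aemeasurable) fun i => (hf i).aestronglyMeasurable

end Factorisation

section FactorisationClass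

variable {Λ' : Finset (B1Eq324BenfattoLemma.Site d)} {P : Matrix Λ' Λ' ℝ} {K₂ : B1Eq324BenfattoLemma.Site d → B1Eq324BenfattoLemma.Site d → ℝ}
  (hK₂ : ∀ x y, K₂ x y = if h : x ∈ Λ' ∧ y ∈ Λ' then (P⁻¹ : Matrix Λ' Λ' ℝ) ⟨x, h.1⟩ ⟨y, h.2⟩ else 0)

include hK₂

/-- **THE BLOCK-DIAGONAL COMPARISON FIELD DECOUPLES THE BOXES**: for the zero-extended kernel `K₂` of the precision
`P = c·B_bd` (`B` symmetric `γ`-coercive on `Λ′`, `B_bd` its block-diagonal part along a partition `π`, `c > 0`), `K₂ s t = 0` whenever `s`, `t` lie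
in different parts (n08-b's `inv_blockDiag_apply_eq_zero`) or off `Λ′` — so `iIndepFun_shift_of_kernel_eq_zero` /
`integral_prod_eq_prod_integral_shift` apply with `Ω_i = π⁻¹{i}`: under the dominating measures of `lintegral_restrict_condFieldK_le/ge_blockDiag` the box
fields ARE independent. [cite: BenfattoEtAl1978, §5 (5.13) p.155 (class substitute; ours)] -/
theorem kernel_blockDiag_eq_zero_of_ne {σ : Type*} [Fintype σ] [DecidableEq σ] {B : Matrix Λ' Λ' ℝ} (hB : ∀ y y', B y y' = B y' y) (π : Λ' → σ)
    {γ c : ℝ} (hγ0 : 0 < γ) (hc : 0 < c) (hγ : ∀ x : Λ' → ℝ, γ * ∑ y, x y ^ 2 ≤ ∑ y, ∑ y', B y y' * x y * x y')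
    (hP : P = c • (Matrix.of fun a b => if π a = π b then B a b else 0 : Matrix Λ' Λ' ℝ))
    {s t : B1Eq324BenfattoLemma.Site d} (hst : ∀ (hs : s ∈ Λ') (ht : t ∈ Λ'), π ⟨s, hs⟩ ≠ π ⟨t, ht⟩) : K₂ s t = 0 := by
  by_cases hs : s ∈ Λ'
  · by_cases ht : t ∈ Λ'
    · rw [hK₂, dif_pos ⟨hs, ht⟩, hP]
      exact inv_blockDiag_apply_eq_zero hB π hγ0 hc hγ (hst hs ht)
    · rw [hK₂, dif_neg fun h => ht h.2]
  · rw [hK₂, dif_neg fun h => hs h.1]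

end FactorisationClass

end Literature.MathematicalPhysics.QuantumFieldTheory.Balaban1983to89.B1Eq324BenfattoKernelComparison

end
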